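import Summits.QuantumFields.GaugeBoot.BootstrapZeroCouplingSlack
import HarnessLib

/-!
# Objectives pinned by the loop equations at `β ≠ 0`; the level-`n` SDP value jumps at `β = 0` (gauge-boot, L1/L4 supplement)

HONEST FRAMING (cell `pub-gaugeboot`, page 1 of every file): the venture produces certified bounds
on lattice expectations at stated coupling, gauge group, dimension and torus size; NOT a mass gap,
NOT a continuum limit, NOT a string tension; NOT Yang–Mills-summit-bearing (barriers
`FixedCouplingUltralocality`, `PerturbativeInvisibility`). Structural; it certifies no number.

## Content

`BootstrapCertificateTransport`: the level-`n` SDP upper (lower) bound of an objective is upper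
(lower) semicontinuous in the coupling `β`. `BootstrapZeroCouplingSlack`: at `β = 0` the level-`n`
SDP determines exactly `V_n`. Is the SDP value CONTINUOUS in `β`? Not in general:

* ★★ `IsBootstrapFeasible.apply_mul_eq_zero_of_hasShiftDeriv_zero` (any lattice),
  `levelValues_eq_singleton_zero_suN` — at `β ≠ 0` the loop equation of a test function
  `f ∈ V_n` NOT depending on the link `i` reads `0 = β φ (f · ∂_{i,a} S)`: the level-`n` SDP pins
  every such product `f · ∂_{i,a}S` (word length `≤ n + 4`) to `0`, which is its Wilson value at
  every `β` (`wilson_integral_mul_torusActionDeriv_eq_zero_suN`);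
* ★★★ `sSup_levelValues_jump_suN`, `not_lowerSemicontinuousAt_sSup_levelValues_suN`,
  `not_upperSemicontinuousAt_sInf_levelValues_suN`, `continuousAt_zero_sSup_levelValues_iff_suN` —
  `SU(N)` on the torus, level `n ≥ 4`, `P = f · ∂_{i,a}S` with `f ∈ V_n` supported on links
  avoiding `i`: the level-`n` SDP upper bound `β ↦ sup` of `P` vanishes at every `β ≠ 0` and is
  CONTINUOUS at `β = 0` if and only if `P ∈ V_n`; when `P ∉ V_n` it jumps UP at `β = 0` (not lower
  semicontinuous; the lower bound jumps down). Mechanism: the row space of the level-`n` loop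
  equations `f' − β f S'` drops rank at `β = 0` (all rows collapse into `V_n`), and the extra
  constraints are lost exactly there; upper semicontinuity
  (`upperSemicontinuous_sSup_levelValues_suN`) is all that survives.

What this is NOT: a decision of `f · ∂_{i,a}S ∈ V_n` for a specific `f` (generically false by word
length — `n + 4` versus `≤ n` — but a formal instance needs a degree argument on the coordinate ring
of `SU(N)^E`, not carried out here); continuity of the SDP value at `β ≠ 0` (where the row rank is
locally constant — sequel); rates.

References: J. F. Bonnans, A. Shapiro, Perturbation Analysis of Optimization Problems (Springer,
2000) Ch. 4 (continuity of optimal-value functions needs a constraint qualification and fails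
where equality constraints degenerate); P. Anderson, M. Kruczenski, Nucl. Phys. B 921 (2017);
V. Kazakov, Z. Zheng, arXiv:2203.11360. Folklore.
-/

noncomputable section

open MeasureTheory Filter Topology NormedSpace
open Literature.MathematicalPhysics.QuantumFieldTheory (LatticeRep Edge GaugeConfig wilsonAction
  wilsonMeasure isProbabilityMeasure_wilsonMeasure)
open Literature.MathematicalPhysics.QuantumLattice

namespace Summit.QuantumFields.GaugeBoot

/-! ## General lattice: objectives pinned at `β ≠ 0` -/

section General

variable {ι : Type*} [DecidableEq ι] {G : Type*} [Group G] [TopologicalSpace G] (r : LatticeRep G)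
  {K : Type*} {k : K → ℝ → G} {X : K → Matrix (Fin r.N) (Fin r.N) ℂ} {S : ι → (ι → G) → ℝ} {β : ℝ}

/-- ★★ **Objectives pinned by the loop equations at `β ≠ 0`.** If the test function `f ∈ V` has
zero derivative along the shift `(i, a)` (e.g. it does not involve the link `i`), its row at `β ≠ 0`
reads `0 = β φ (f S_i')`: every level-`V` feasible `φ` has `φ (f S_i') = 0`. [folklore] -/
theorem IsBootstrapFeasible.apply_mul_eq_zero_of_hasShiftDeriv_zero {V : Set C(ι → G, ℝ)}
    {φ : C(ι → G, ℝ) →ₗ[ℝ] ℝ} (hφ : IsBootstrapFeasible r k S β V φ) (hβ : β ≠ 0)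
    {f : C(ι → G, ℝ)} (hf : f ∈ V) {i : ι} {a : K} (hfi : HasShiftDeriv k i a f 0)
    {S' : C(ι → G, ℝ)}
    (hS'd : ∀ U, HasDerivAt (fun t => S i (Function.update U i (k a t * U i))) (S' U) 0) :
    φ (f * S') = 0 := by
  obtain ⟨S'', -, hS''d, hrows⟩ := hφ.2.2 i a
  have he : S'' = S' := ContinuousMap.ext fun U => (hS''d U).unique (hS'd U)
  have h := hrows f hf 0 (Subalgebra.zero_mem _) hfi
  rw [map_zero, he] at h
  exact (mul_eq_zero.1 h.symm).resolve_left hβ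

/-- A word observable on links avoiding `i` has zero derivative along every shift at `i`. -/
theorem hasShiftDeriv_zero_of_not_mem [ContinuousMul G] (hk : ∀ a s t, k a (s + t) = k a s * k a t)
    (hX : ∀ a t, r.ρ (k a t) = exp ((t : ℂ) • X a)) {T : Set ι} {n : ℕ} {i : ι} (hi : i ∉ T)
    (a : K) {f : C(ι → G, ℝ)} (hf : f ∈ wordSpace r T n) : HasShiftDeriv k i a f 0 := by
  have h := hasShiftDeriv_sderiv_of_mem_polyAlgebra hk hX i a (mem_polyAlgebra_of_mem_wordSpace r hf)
  rwa [sderiv_eq_zero_of_not_mem hk hX hi a hf] at h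

end General

/-! ## `SU(N)` on the torus: the jump at `β = 0` -/

section SuN

variable {d L : ℕ} [NeZero L] (N : ℕ)

/-- ★★ **At `β ≠ 0` the level-`n` loop equations pin `f · ∂_{i,a}S` to `0`** for every test
function `f` of word length `≤ n` on links avoiding `i` (`SU(N)`, torus; the row of `f` at
`(i, a)`). [folklore] -/
theorem levelValues_eq_singleton_zero_suN {n : ℕ} {β : ℝ} (hβ : β ≠ 0) {T : Set (Edge d L)}
    {i : Edge d L} (hi : i ∉ T) (a : SuGenerator N)
    {f : C(GaugeConfig d L (Matrix.specialUnitaryGroup (Fin N) ℂ), ℝ)}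
    (hf : f ∈ wordSpace (fundamentalLatticeRep N) T n) :
    levelValuesSuN (d := d) (L := L) N β n
        (f * torusActionDeriv (fundamentalLatticeRep N) (suExp N) i a) = {0} := by
  have key : ∀ φ, IsBootstrapFeasible (fundamentalLatticeRep N) (suExp N)
      (fun _ => wilsonAction (fundamentalRep (Fin N))) β
      (wordTruncation (ι := Edge d L) (fundamentalLatticeRep N) n) φ →
      φ (f * torusActionDeriv (fundamentalLatticeRep N) (suExp N) i a) = 0 := fun φ hφ =>
    hφ.apply_mul_eq_zero_of_hasShiftDeriv_zero (fundamentalLatticeRep N) hβ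
      (mem_wordTruncation_of_mem_wordSpace _ hf)
      (hasShiftDeriv_zero_of_not_mem (fundamentalLatticeRep N) (suExp_add N)
        (X := fun X : SuGenerator N => (X : Matrix (Fin N) (Fin N) ℂ)) (rho_suExp N) hi a hf)
      (hasDerivAt_torusActionDeriv (fundamentalLatticeRep N) (suExp_add N)
        (X := fun X : SuGenerator N => (X : Matrix (Fin N) (Fin N) ℂ)) (rho_suExp N) i a)
  refine Set.eq_singleton_iff_unique_mem.2 ⟨?_, fun t ht => ?_⟩
  · obtain ⟨φ, hφ, hφP⟩ := wilson_mem_levelValues_suN N β n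
      (f * torusActionDeriv (fundamentalLatticeRep N) (suExp N) i a)
    have h := key φ hφ
    rw [hφP] at h
    rw [← h]
    exact ⟨φ, hφ, hφP⟩
  · obtain ⟨φ, hφ, rfl⟩ := ht
    exact key φ hφ

/-- **The Wilson value of `f · ∂_{i,a}S` is `0` at every `β`** (`f` a word observable on links
avoiding `i`): at `β ≠ 0` by the pinning row; at `β = 0` because `f · ∂_{i,a}S = ∂_{i,a}(f S)` is a
shift derivative (Leibniz, `∂_{i,a} f = 0`), killed by the Haar state. [folklore] -/
theorem wilson_integral_mul_torusActionDeriv_eq_zero_suN (β : ℝ) {n : ℕ} {T : Set (Edge d L)}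
    {i : Edge d L} (hi : i ∉ T) (a : SuGenerator N)
    {f : C(GaugeConfig d L (Matrix.specialUnitaryGroup (Fin N) ℂ), ℝ)}
    (hf : f ∈ wordSpace (fundamentalLatticeRep N) T n) :
    ∫ U, (f * torusActionDeriv (fundamentalLatticeRep N) (suExp N) i a) U
      ∂(wilsonMeasure (fundamentalRep (Fin N)) β) = 0 := by
  by_cases hβ : β = 0
  · subst hβ
    haveI : IsProbabilityMeasure (wilsonMeasure (d := d) (L := L) (fundamentalRep (Fin N)) 0) :=
      isProbabilityMeasure_wilsonMeasure (ρ := fundamentalRep (Fin N)) (continuous_fundamentalRep _) 0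
    have hfA := mem_polyAlgebra_of_mem_wordSpace (fundamentalLatticeRep N) hf
    have hSA := mem_polyAlgebra_of_mem_wordSpace (fundamentalLatticeRep N)
      (wilsonActionCM_mem_wordSpace (d := d) (L := L) (fundamentalLatticeRep N))
    -- `f S' = ∂(f S)` since `∂ f = 0`
    have hprod : f * torusActionDeriv (fundamentalLatticeRep N) (suExp N) i a =
        sderiv (suExp N) i a (f * wilsonActionCM (d := d) (L := L) (fundamentalLatticeRep N)) := by
      rw [sderiv_mul (suExp_add N) (X := fun X : SuGenerator N => (X : Matrix (Fin N) (Fin N) ℂ))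
        (rho_suExp N) i a hfA hSA, sderiv_eq_zero_of_not_mem (suExp_add N)
        (X := fun X : SuGenerator N => (X : Matrix (Fin N) (Fin N) ℂ)) (rho_suExp N) hi a hf,
        zero_mul, zero_add]
      rfl
    have hfeas := isBootstrapFeasible_wilson_suN (d := d) (L := L) N 0 _ rfl subset_rfl
    have h := rows_zero_of_feasible (fundamentalLatticeRep N) (suExp_add N)
      (X := fun X : SuGenerator N => (X : Matrix (Fin N) (Fin N) ℂ)) (rho_suExp N) hfeas i a
      ((polyAlgebra (ι := Edge d L) (fundamentalLatticeRep N)).mul_mem hfA hSA)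
    rw [← hprod, expectationFunctional_apply] at h
    exact h
  · have h := levelValues_eq_singleton_zero_suN N hβ hi a hf (n := n)
    have hw := wilson_mem_levelValues_suN N β n
      (f * torusActionDeriv (fundamentalLatticeRep N) (suExp N) i a)
    rw [h, Set.mem_singleton_iff] at hw
    exact hw

/-- `f · ∂_{i,a}S` is a test function of word length `≤ n + 4`. -/
theorem mul_torusActionDeriv_mem_wordTruncation_suN {n : ℕ} {T : Set (Edge d L)} (i : Edge d L)
    (a : SuGenerator N) {f : C(GaugeConfig d L (Matrix.specialUnitaryGroup (Fin N) ℂ), ℝ)}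
    (hf : f ∈ wordSpace (fundamentalLatticeRep N) T n) :
    f * torusActionDeriv (fundamentalLatticeRep N) (suExp N) i a ∈
      wordTruncation (ι := Edge d L) (fundamentalLatticeRep N) (n + 4) :=
  mul_mem_wordTruncation_add _ (mem_wordTruncation_of_mem_wordSpace _ hf)
    (mem_wordTruncation_of_mem_wordSpace _ (torusActionDeriv_mem (fundamentalLatticeRep N)
      (suExp_add N) (X := fun X : SuGenerator N => (X : Matrix (Fin N) (Fin N) ℂ)) (rho_suExp N) i a))

/-- ★★★ **The jump at `β = 0`.** `SU(N)`, torus, level `n ≥ 4`, `f ∈ V_n` supported on links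
avoiding `i`, `P = f · ∂_{i,a}S`: the level-`n` SDP upper bound of `P` is `0` at every `β ≠ 0`,
while at `β = 0` it is STRICTLY POSITIVE as soon as `P ∉ V_n` (and the lower bound strictly
negative). [folklore] -/
theorem sSup_levelValues_jump_suN {n : ℕ} (hn : 4 ≤ n) {T : Set (Edge d L)} {i : Edge d L}
    (hi : i ∉ T) (a : SuGenerator N) {f : C(GaugeConfig d L (Matrix.specialUnitaryGroup (Fin N) ℂ), ℝ)}
    (hf : f ∈ wordSpace (fundamentalLatticeRep N) T n)
    (hP : f * torusActionDeriv (fundamentalLatticeRep N) (suExp N) i a ∉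
      wordTruncation (ι := Edge d L) (fundamentalLatticeRep N) n) :
    (∀ β : ℝ, β ≠ 0 →
        sSup (levelValuesSuN (d := d) (L := L) N β n
          (f * torusActionDeriv (fundamentalLatticeRep N) (suExp N) i a)) = 0 ∧
        sInf (levelValuesSuN (d := d) (L := L) N β n
          (f * torusActionDeriv (fundamentalLatticeRep N) (suExp N) i a)) = 0) ∧
      0 < sSup (levelValuesSuN (d := d) (L := L) N 0 n
          (f * torusActionDeriv (fundamentalLatticeRep N) (suExp N) i a)) ∧
      sInf (levelValuesSuN (d := d) (L := L) N 0 n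
          (f * torusActionDeriv (fundamentalLatticeRep N) (suExp N) i a)) < 0 := by
  set P := f * torusActionDeriv (fundamentalLatticeRep N) (suExp N) i a with hPdef
  refine ⟨fun β hβ => ?_, ?_⟩
  · rw [levelValues_eq_singleton_zero_suN N hβ hi a hf, csSup_singleton, csInf_singleton]
    exact ⟨rfl, rfl⟩
  have hPc : P ∈ certDomainSuN (d := d) (L := L) N 0 n :=
    mem_certDomainSuN_of_mem_wordTruncation N 0 (by omega)
      (mul_torusActionDeriv_mem_wordTruncation_suN N i a hf)
  obtain ⟨lo, hi', hIcc, hW⟩ := levelValues_eq_Icc_suN N 0 hPc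
  have hlohi : lo ≤ hi' := hW.1.trans hW.2
  have h0 : ∫ U, P U ∂(wilsonMeasure (fundamentalRep (Fin N)) 0) = 0 :=
    wilson_integral_mul_torusActionDeriv_eq_zero_suN N 0 hi a hf
  obtain ⟨⟨t₁, ht₁, hlt₁⟩, ⟨t₂, ht₂, hlt₂⟩⟩ := exists_mem_levelValues_zero_lt_gt_suN N (n := n) hP
  rw [h0] at hlt₁ hlt₂
  rw [hIcc] at ht₁ ht₂ ⊢
  rw [csSup_Icc hlohi, csInf_Icc hlohi]
  exact ⟨lt_of_lt_of_le hlt₂ ht₂.2, lt_of_le_of_lt ht₁.1 hlt₁⟩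

/-- A function vanishing off `0` is not eventually `> y > 0` near `0`. -/
theorem not_eventually_lt_of_eq_zero_off_zero {g : ℝ → ℝ} (hg : ∀ β : ℝ, β ≠ 0 → g β = 0) {y : ℝ}
    (hy : 0 < y) : ¬ ∀ᶠ β in 𝓝 (0 : ℝ), y < g β := by
  intro h
  obtain ⟨ε, hε, hball⟩ := Metric.eventually_nhds_iff.1 h
  have hε2 : (ε / 2 : ℝ) ≠ 0 := by positivity
  have h1 : y < g (ε / 2) := hball (by
    rw [Real.dist_eq, sub_zero, abs_of_pos (by positivity)]; linarith)
  rw [hg _ hε2] at h1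
  exact lt_irrefl _ (hy.trans h1)

/-- ★★★ **The level-`n` SDP upper bound is NOT lower semicontinuous at `β = 0`** (for the pinned
objective `P = f · ∂_{i,a}S ∉ V_n`, `n ≥ 4`): it jumps up at `β = 0`. Upper semicontinuity
(`upperSemicontinuous_sSup_levelValues_suN`) is all that holds there. [folklore] -/
theorem not_lowerSemicontinuousAt_sSup_levelValues_suN {n : ℕ} (hn : 4 ≤ n) {T : Set (Edge d L)}
    {i : Edge d L} (hi : i ∉ T) (a : SuGenerator N)
    {f : C(GaugeConfig d L (Matrix.specialUnitaryGroup (Fin N) ℂ), ℝ)}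
    (hf : f ∈ wordSpace (fundamentalLatticeRep N) T n)
    (hP : f * torusActionDeriv (fundamentalLatticeRep N) (suExp N) i a ∉
      wordTruncation (ι := Edge d L) (fundamentalLatticeRep N) n) :
    ¬ LowerSemicontinuousAt (fun β : ℝ => sSup (levelValuesSuN (d := d) (L := L) N β n
        (f * torusActionDeriv (fundamentalLatticeRep N) (suExp N) i a))) 0 := by
  obtain ⟨hoff, hpos, -⟩ := sSup_levelValues_jump_suN N hn hi a hf hP
  intro h
  have hy := h _ (half_lt_self hpos)
  exact not_eventually_lt_of_eq_zero_off_zero (fun β hβ => (hoff β hβ).1) (half_pos hpos) hy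

/-- ★★ **The lower bound is not upper semicontinuous at `β = 0`** (it jumps down). [folklore] -/
theorem not_upperSemicontinuousAt_sInf_levelValues_suN {n : ℕ} (hn : 4 ≤ n) {T : Set (Edge d L)}
    {i : Edge d L} (hi : i ∉ T) (a : SuGenerator N)
    {f : C(GaugeConfig d L (Matrix.specialUnitaryGroup (Fin N) ℂ), ℝ)}
    (hf : f ∈ wordSpace (fundamentalLatticeRep N) T n)
    (hP : f * torusActionDeriv (fundamentalLatticeRep N) (suExp N) i a ∉
      wordTruncation (ι := Edge d L) (fundamentalLatticeRep N) n) :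
    ¬ UpperSemicontinuousAt (fun β : ℝ => sInf (levelValuesSuN (d := d) (L := L) N β n
        (f * torusActionDeriv (fundamentalLatticeRep N) (suExp N) i a))) 0 := by
  obtain ⟨hoff, -, hneg⟩ := sSup_levelValues_jump_suN N hn hi a hf hP
  intro h
  set g := fun β : ℝ => sInf (levelValuesSuN (d := d) (L := L) N β n
    (f * torusActionDeriv (fundamentalLatticeRep N) (suExp N) i a)) with hg
  have hy : ∀ᶠ β in 𝓝 (0 : ℝ), g β < g 0 / 2 := h _ (by rw [hg]; linarith)
  have hy' : ∀ᶠ β in 𝓝 (0 : ℝ), -(g 0 / 2) < (fun β => -g β) β := by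
    filter_upwards [hy] with β hβ
    exact neg_lt_neg hβ
  refine not_eventually_lt_of_eq_zero_off_zero (g := fun β => -g β)
    (fun β hβ => by simp only [hg, (hoff β hβ).2, neg_zero]) (by linarith) hy'

/-- ★★★ **Continuity at `β = 0` is decided by membership in `V_n`.** For the pinned objective
`P = f · ∂_{i,a}S` (`f ∈ V_n` on links avoiding `i`, `n ≥ 4`): the level-`n` SDP upper bound is
continuous at `β = 0` if and only if `P ∈ V_n` (then it is identically `0`). [folklore] -/
theorem continuousAt_zero_sSup_levelValues_iff_suN {n : ℕ} (hn : 4 ≤ n) {T : Set (Edge d L)}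
    {i : Edge d L} (hi : i ∉ T) (a : SuGenerator N)
    {f : C(GaugeConfig d L (Matrix.specialUnitaryGroup (Fin N) ℂ), ℝ)}
    (hf : f ∈ wordSpace (fundamentalLatticeRep N) T n) :
    ContinuousAt (fun β : ℝ => sSup (levelValuesSuN (d := d) (L := L) N β n
        (f * torusActionDeriv (fundamentalLatticeRep N) (suExp N) i a))) 0 ↔
      f * torusActionDeriv (fundamentalLatticeRep N) (suExp N) i a ∈
        wordTruncation (ι := Edge d L) (fundamentalLatticeRep N) n := by
  refine ⟨fun h => ?_, fun hP => ?_⟩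
  · by_contra hP
    exact not_lowerSemicontinuousAt_sSup_levelValues_suN N hn hi a hf hP h.lowerSemicontinuousAt
  · have hconst : (fun β : ℝ => sSup (levelValuesSuN (d := d) (L := L) N β n
        (f * torusActionDeriv (fundamentalLatticeRep N) (suExp N) i a))) = fun _ => 0 := by
      funext β
      by_cases hβ : β = 0
      · subst hβ
        rw [levelValues_zero_eq_singleton_suN N le_rfl hP, csSup_singleton]
        exact wilson_integral_mul_torusActionDeriv_eq_zero_suN N 0 hi a hf
      · rw [levelValues_eq_singleton_zero_suN N hβ hi a hf, csSup_singleton]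
    rw [hconst]
    exact continuousAt_const

end SuN

end Summit.QuantumFields.GaugeBoot

end
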